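/-
Copyright (c) 2026. Released under Apache 2.0 license as described in the file LICENSE.
-/
import Mathlib.Analysis.Matrix.Spectrum
import Mathlib.Analysis.Matrix.PosDef
import Mathlib.Analysis.Matrix.Order
import Mathlib.LinearAlgebra.Matrix.SchurComplement
import Mathlib.LinearAlgebra.Matrix.Rank
import Literature.MathematicalPhysics.QuantumFieldTheory.Balaban1983to89.T4TerritoryReflection

/-!
# T4 — the Gaussian COLLAR LEMMA for the territory comparison (E2-rel (b), lower half, piece O2′ (a))

Pure linear algebra, kernel-proved, **no cited facts, no new named facts** ([folklore]: the spectral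
theorem, the Weinstein–Aronszajn identity, the two Schur-complement criteria for positive
semidefiniteness of a symmetric block matrix — all from Mathlib — and Fischer's inequality, which is
re-derived here).  This module discharges, IN THE GAUSSIAN-STEP MODEL of
`T4TerritoryReflection` (header there, §(M)), the half **(a) "Schur-complement / collar locality of
log det"** of the located open piece O2′ = `T4TerritoryReflection.NormLocality` (cell record
`t4/T4-EST-U5Ea-E2relb.md`, GAPS G-pv06g10-1); the half **(b) "background oscillation"** is NOT
touched and stays NOT PRINTED / open (it is exactly the hypothesis `hnorm` of
`normLocality_of_collar` below).

## Dictionary (Gaussian normalisations ↔ determinants)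

For a real symmetric positive definite precision form `Q` on `ℝ^N`, the Gaussian normalisation is
`Z(Q) = ∫ exp(−½⟨x, Q x⟩) dx = (2π)^{N/2} (det Q)^{−1/2}`.  Split the variables of one
renormalisation step into the TERRITORY block (index type `m`) and the EXTERIOR block (`k`), so the
step's fluctuation form is the symmetric block matrix `M = [[A, B], [Bᴴ, D]]` (`A` = territory
block, `D` = exterior block, `B` = the territory × exterior coupling; v1/v1.1 added here «supported
on a COLLAR: its rank is at most the number of coupled boundary sites» — see READING OF `B` (v1.2)
below for the corrected identification: that clause holds for a finite-range TRUNCATION of `B`, not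
for the printed non-local coupling verbatim).  Then (Schur)
`det M = det D · det (A − B D⁻¹ Bᴴ)`, hence

  `Z(M) = Z(A) · Z(D) · √q`,   `q := det A · det D / det M`  (the COLLAR RATIO),

i.e. the territory's share of the GLOBAL normalisation, `Z(M) / Z(D)` (the conditional
normalisation), equals its BLOCK normalisation `Z(A)` (= `nT` of `T4TerritoryReflection.SmallFieldMass`
/ `NormLocality`) times the collar factor `√q`.  The theorems below bound the collar ratio by the
coupling block ONLY THROUGH ITS RANK and the two spectral constants of the form:

READING OF `B` (v1.2; identification only — NO theorem of this file changes, `rank B ≤ r` is and was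
a HYPOTHESIS, the binder `hr` of `det_mul_det_le_pow_mul_det_fromBlocks` / `collarRatio_bounds`).
Print's k-th fluctuation form is built on the operator Δ^{(k)}(U_{k+1}) of [B12] p.267 («The
quadratic form in B′ above is equal to −1/2⟨B′, Δ^{(k)}B′⟩, see the definition (3.156) [13]»; the
whole step integral is (2.10) p.267, render re-read as an image by generation 11), which is NOT of
finite range, so the territory × exterior block of the GLOBAL form is not literally collar-supported
and «rank B ≤ #collar sites» is FALSE VERBATIM for it (co-seat finding, cell GAPS G-pv10-15; this
lineage's ruling, record `t4/T4-EST-U5Ea-E2relb.md` v1.7/v1.8 §3‴ Q3: repair (b) adopted).  The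
corrected identification: write `B = B_w + B_far`, `B_w` = the RANGE-`w` TRUNCATION (the rows of
territory sites farther than `w` from the exterior set to zero), so `rank B_w ≤ #(territory sites
within w of the exterior)` BY SUPPORT (rank ≤ number of nonzero rows) — THIS is the `B` fed to `hr`;
the far part is priced separately by the kernel lemma
`T4LogDetOscillation.abs_log_det_sub_log_det_le` (`|log det M − log det M_w| ≤ (1/c) · Σ|M − M_w|`
for `M, M_w ≥ c • 1`, same lineage, zero cited facts), i.e. an extra factor
`exp ((2/c) · Σ_{i,j} |B_far i j|)` on the collar ratio — a PERIMETER law, d′-affordable, PROVIDED the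
entries of the coupling decay exponentially in the distance (then `Σ|B_far| ≤ C₀e^{−δ₀w} · #∂T`).
That decay is a MODEL HYPOTHESIS here, NOT a cited fact: the printed exponential-decay statements
nearest to it ([B12] (0.24)–(0.26) p.257 «|E^{(j)}(X, U)| ≤ E₀ exp(−κd_j(X))» and (1.18) p.263,
read by generation 10 of this lineage, record [R15]/[R16]) concern the localized effective-action
terms E^{(j)}(X), not the entries of Δ^{(k)}(U_{k+1}) as such (status recorded in G-pv10-15: «NOT PRINTED;
false verbatim for the global operator; true after finite-range truncation»).  Both uniform
positivity binders (`hM` for `M` and its analogue for `M_w`) stay explicit hypotheses.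

* `collarRatio_bounds`:  if `M ≥ c • 1` (`c > 0`: uniform positivity of the fluctuation form — a
  MODEL hypothesis; [B12] p.267 only DEFINES the fluctuation form by reference, «The quadratic form in
  B′ above is equal to −1/2⟨B′, Δ^{(k)}B′⟩, see the definition (3.156) [13]» ([13] there = CMP 99
  (1985) 389–434), and p.268 names the «covariance C^{(k)} = C^{(k)}(U_{k+1}) = (C*Δ^{(k)}C)⁻¹»; NO
  lower bound for `Δ^{(k)}(U)` is printed on pp.266–268 (v1 of this docstring said otherwise: corrected
  in v1.1 after the cross-read, cell GAPS C-pv06g10-4); v1.2 LOCATION POINTER: at the R′-level, for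
  the LOCALIZED denominator (1.2) of [B16] a lower bound IS printed — p.358 (render p004 read as an
  image by generation 11) «This integral is in the denominator of (1.1), hence we are interested only
  in a lower bound, which follows from the boundedness of the quadratic form. The integral is bounded
  from below by exp(−O(1)|Λ|) = exp(−O(M⁴)).», resting on (1.9) «⟨H_{1,k}B′, Δ₁(ζ₀)H_{1,k}B′⟩ ≥
  γ₀/(2d(100M)⁵) ‖B′‖²» «for g_k sufficiently small» — an object that lives in the slot `own` of
  `T4TerritoryComparison` (consumed inside (1.79)), NOT in `norm`/`terr` (this lineage's ruling,
  record §3‴; co-seat pointer G-pv10-15 item 5), so it is cited for LOCATION ONLY and changes no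
  binder; uniform positivity is not used as a hypothesis anywhere in this file
  beyond the explicit binder `hM`), `A ≤ a • 1` and `rank B ≤ r`, then
  `1 ≤ q ≤ (1 + a/c)^r`.
  Lower bound = Fischer's inequality `det M ≤ det A · det D`; upper bound = the collar inequality.
* `normLocality_of_collar`:  consequently, if the re-inserted reference normalisation satisfies
  `norm ≤ nT · √q` pointwise (the model identification + the (b)-half) and the collar rank is
  dominated by the territory cost, `NormLocality` holds with constant `log (1 + a/c) / 2` and zero
  slack — a PERIMETER-law constant, d′-affordable in the sense of `T4TerritoryComparison.SlackDPrime`.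

## The linear algebra (all over `ℝ`)

* §1 `det_one_add_le_pow_of_rank_le`: `N` symmetric PSD, `N ≤ l • 1`, `rank N ≤ r` ⇒
  `1 ≤ det (1 + N) ≤ (1 + l)^r` (spectral theorem: `det (1 + N) = ∏ (1 + νᵢ)`, at most `rank N`
  factors differ from `1`, each `≤ 1 + l`).
* §2 `det_add_le_pow_mul_det` / `det_le_det_add`: `S` PD, `W` PSD, `rank W ≤ r`, `W ≤ l • S` ⇒
  `det S ≤ det (S + W) ≤ (1 + l)^r det S` — congruence-free: Gram factor `W = Xᴴ X` (positive square
  root via the continuous functional calculus), Weinstein–Aronszajn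
  `det (S + Xᴴ X) = det S · det (1 + X S⁻¹ Xᴴ)`, and the push-through
  `Xᴴ X ≤ l • S ⇒ X S⁻¹ Xᴴ ≤ l • 1` by reading the block matrix `[[l • S, Xᴴ], [X, 1]]` with both
  Schur criteria (`Matrix.PosDef.fromBlocks₁₁/₂₂`); no matrix square root enters any statement.
* §3 block form: `schur_sub_smul_one_posSemidef` (uniform positivity passes to the Schur complement,
  by completing the square `y = −D⁻¹Bᴴx` in `Matrix.schur_complement_eq₂₂`), `det_fromBlocks_le`
  (Fischer), `det_mul_det_le_pow_mul_det_fromBlocks` (collar), `collarRatio_bounds`.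
* §4 packaging: `sqrt_le_exp_of_le_pow`, `normLocality_of_collar`.

## Honest framing

A kernel lemma about finite-dimensional Gaussian integrals.  It is NOT a proof of E2-rel (b), NOT a
statement about the manuscripts' renormalisation steps beyond the model (M) of
`T4TerritoryReflection`, and NOT summit progress (rung (B)+1 ≠ infinite volume / mass gap / Clay).
What it changes in the census of the lower half of E2-rel (b): O2′ = (a) ∧ (b) with (a) now KERNEL in
the model (constant `log (1 + a/c) / 2` per unit of collar rank); (b) and the model claim (M) remain.

References (attribution only; nothing is cited as a hypothesis): E. Fischer, Über den Hadamardschen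
Determinantensatz, Arch. Math. Phys. (3) 13 (1908) 32–40 [folklore]; [B12] = T. Bałaban,
Renormalization group approach to lattice gauge field theories. I, Commun. Math. Phys. 109 (1987)
249–301, (2.8)–(2.14) pp.266–268 (the fluctuation integral, its Gaussian measure dμ_{C^{(k)}} and the
normalisation [log Z^{(k)}(U_{k+1}) − log Z^{(k)}(1)] in the new action (2.12)) for the model features
(READING; v1 mis-printed the journal locator as «122 (1989) 175–202», which is the large-field paper —
corrected in v1.1); v1.2 adds, LOCATION ONLY (renders read as images by generation 11; added on the
locator correction §2(ii) of the co-seat identification record `t4/T4-EST-U5Ea-E2relb-ident.md` v1.1,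
used for WHERE TO LOOK only): [B12] (2.10) p.267 (the whole k-th step integral); [B16] = T. Bałaban,
Large field renormalization. II, Commun. Math. Phys. 122 (1989) 355–392, pp.356–358 — (1.1) the
R′-ratio, (1.2) its denominator as a box-restricted Gaussian-type integral in B′ with ONE linear term
and V «at least of third order», (1.7)–(1.9) positivity of the quadratic form, p.358 the denominator's
lower bound quoted above, (1.10)/(1.11) «E_k(Λ) = (−½d(g) log g_k^{−2} + log σ₀)|Λ^{(k)}∖G₀|»,
«|I(U₀)| < O(1) log M|Λ| < O(1)M⁵.»; [B15] = T. Bałaban, Large field renormalization. I. The basic step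
of the R operation, Commun. Math. Phys. 122 (1989) 175–202, p.192 (1.73) «Λ = (Ω^{~4}_{k₀+1})^c ∩ Z.»
(«the domain on which we integrate out all field variables»), p.201 (1.100) (definition of R′ρ_k, the
same normalized ratio per component) and (1.101) «χ(Λ_i) = χ({|(1/i) log V′(b)| < M₀ε_k for b ∈ Λ_i})».
v1.2 (unit `b2b-balaban-pv06` gen 11, journal CLAIM PV06-COLLAR-TRUNC-DOCFIX*) is HEADER-ONLY: every
declaration, docstring and proof below this module docstring is byte-identical to v1.1.
-/

open Matrix

namespace Literature.MathematicalPhysics.QuantumFieldTheory.Balaban1983to89.T4CollarDeterminant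

/-! ## §1 Rank-limited determinant growth -/

section Core

variable {n : Type*} [Fintype n] [DecidableEq n]

/-- Conjugation by a pair `U, V` with `V * U = 1` preserves the determinant. [folklore] -/
theorem det_conj_of_mul_eq_one {U V : Matrix n n ℝ} (hVU : V * U = 1) (M : Matrix n n ℝ) :
    (U * M * V).det = M.det := by
  rw [det_mul, det_mul]
  calc U.det * M.det * V.det = M.det * (V * U).det := by rw [det_mul]; ring
    _ = M.det := by rw [hVU, det_one, mul_one]

/-- `det (1 + N) = ∏ (1 + νᵢ)` over the eigenvalues of a real symmetric `N`. [folklore] -/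
theorem det_one_add_eq_prod_eigenvalues {N : Matrix n n ℝ} (hN : N.IsHermitian) :
    (1 + N).det = ∏ i, (1 + hN.eigenvalues i) := by
  have hsp := hN.spectral_theorem
  set U := hN.eigenvectorUnitary with hU
  have h1 : (1 : Matrix n n ℝ) + N =
      Unitary.conjStarAlgAut ℝ (Matrix n n ℝ) U (1 + diagonal (RCLike.ofReal ∘ hN.eigenvalues)) := by
    rw [map_add, map_one, ← hsp]
  rw [h1, Unitary.conjStarAlgAut_apply, det_conj_of_mul_eq_one (Unitary.coe_star_mul_self U),
    ← diagonal_one, diagonal_add, det_diagonal]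
  simp

/-- Eigenvalues of `N` are at most `l` when `l • 1 - N` is positive semidefinite. [folklore] -/
theorem eigenvalues_le_of_posSemidef {N : Matrix n n ℝ} (hN : N.IsHermitian) {l : ℝ}
    (h : (l • (1 : Matrix n n ℝ) - N).PosSemidef) (i : n) : hN.eigenvalues i ≤ l := by
  have hv := hN.eigenvalues_eq i
  have hnorm : ‖hN.eigenvectorBasis i‖ = 1 := hN.eigenvectorBasis.orthonormal.1 i
  have hvv : star (⇑(hN.eigenvectorBasis i)) ⬝ᵥ ⇑(hN.eigenvectorBasis i) = 1 := by
    have h2 : inner ℝ (hN.eigenvectorBasis i) (hN.eigenvectorBasis i) = (1 : ℝ) := by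
      rw [real_inner_self_eq_norm_sq, hnorm, one_pow]
    rw [EuclideanSpace.inner_eq_star_dotProduct] at h2
    rwa [dotProduct_comm] at h2
  have hq := h.dotProduct_mulVec_nonneg (⇑(hN.eigenvectorBasis i))
  rw [sub_mulVec, dotProduct_sub, Matrix.smul_mulVec, one_mulVec, dotProduct_smul, hvv] at hq
  simp only [smul_eq_mul, mul_one, sub_nonneg] at hq
  rw [hv]
  simpa using hq

omit [DecidableEq n] in
/-- A product of factors `1 + νᵢ` with `0 ≤ νᵢ ≤ l` and at most `r` nonzero `νᵢ`
is at most `(1 + l) ^ r`. [folklore] -/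
theorem prod_one_add_le_pow {ν : n → ℝ} {l : ℝ} (hl : 0 ≤ l) (h0 : ∀ i, 0 ≤ ν i)
    (hle : ∀ i, ν i ≤ l) {r : ℕ} (hcard : Fintype.card {i // ν i ≠ 0} ≤ r) :
    ∏ i, (1 + ν i) ≤ (1 + l) ^ r := by
  classical
  set s := Finset.univ.filter (fun i => ν i ≠ 0) with hs
  have h1 : ∏ i, (1 + ν i) = ∏ i ∈ s, (1 + ν i) := by
    rw [hs, Finset.prod_filter]
    refine Finset.prod_congr rfl fun i _ => ?_
    by_cases hi : ν i ≠ 0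
    · simp [hi]
    · simp only [ne_eq, not_not] at hi; simp [hi]
  rw [h1]
  calc ∏ i ∈ s, (1 + ν i) ≤ ∏ _i ∈ s, (1 + l) :=
        Finset.prod_le_prod (fun i _ => by linarith [h0 i]) (fun i _ => by linarith [hle i])
    _ = (1 + l) ^ s.card := Finset.prod_const _
    _ ≤ (1 + l) ^ r := by
        apply pow_le_pow_right₀ (by linarith)
        rwa [hs, ← Fintype.card_subtype]

omit [DecidableEq n] in
/-- `1 ≤ ∏ (1 + νᵢ)` for nonnegative `νᵢ`. [folklore] -/
theorem one_le_prod_one_add {ν : n → ℝ} (h0 : ∀ i, 0 ≤ ν i) : 1 ≤ ∏ i, (1 + ν i) := by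
  calc (1 : ℝ) = ∏ _i : n, (1 : ℝ) := by simp
    _ ≤ ∏ i, (1 + ν i) :=
        Finset.prod_le_prod (fun _ _ => zero_le_one) (fun i _ => by linarith [h0 i])

/-- **Rank-limited determinant growth.** For a real symmetric positive semidefinite `N` with
`N ≤ l • 1` and `rank N ≤ r`: `det (1 + N) ≤ (1 + l) ^ r`. [folklore] -/
theorem det_one_add_le_pow_of_rank_le {N : Matrix n n ℝ} (hN : N.PosSemidef) {l : ℝ}
    (hl : 0 ≤ l) (hle : (l • (1 : Matrix n n ℝ) - N).PosSemidef) {r : ℕ} (hr : N.rank ≤ r) :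
    (1 + N).det ≤ (1 + l) ^ r := by
  rw [det_one_add_eq_prod_eigenvalues hN.1]
  refine prod_one_add_le_pow hl (hN.eigenvalues_nonneg) (eigenvalues_le_of_posSemidef hN.1 hle) ?_
  rwa [← hN.1.rank_eq_card_non_zero_eigs]

/-- `1 ≤ det (1 + N)` for positive semidefinite `N`. [folklore] -/
theorem one_le_det_one_add {N : Matrix n n ℝ} (hN : N.PosSemidef) : 1 ≤ (1 + N).det := by
  rw [det_one_add_eq_prod_eigenvalues hN.1]
  exact one_le_prod_one_add hN.eigenvalues_nonneg


end Core

/-! ## §2 Congruence-free generalisation: `det S ≤ det (S + W) ≤ (1 + l)^r det S` -/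

section General

open scoped MatrixOrder

variable {n : Type*} [Fintype n] [DecidableEq n]

/-- Gram factorisation of a real positive semidefinite matrix through a symmetric factor
(the positive square root, via the continuous functional calculus). [folklore] -/
theorem exists_symm_mul_self_of_posSemidef {W : Matrix n n ℝ} (hW : W.PosSemidef) :
    ∃ X : Matrix n n ℝ, X.PosSemidef ∧ X * X = W := by
  refine ⟨CFC.sqrt W, (CFC.sqrt_nonneg W).posSemidef, ?_⟩
  exact CFC.sqrt_mul_sqrt_self W hW.nonneg

/-- Weinstein–Aronszajn rearrangement: `det (S + Xᴴ X) = det S · det (1 + X S⁻¹ Xᴴ)`. [folklore] -/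
theorem det_add_conjTranspose_mul_self {m : Type*} [Fintype m] [DecidableEq m]
    {S : Matrix n n ℝ} (hS : S.PosDef) (X : Matrix m n ℝ) :
    (S + Xᴴ * X).det = S.det * (1 + X * S⁻¹ * Xᴴ).det := by
  have hSu : IsUnit S.det := (isUnit_iff_isUnit_det S).mp hS.isUnit
  have h1 : S + Xᴴ * X = S * (1 + S⁻¹ * Xᴴ * X) := by
    rw [Matrix.mul_add, Matrix.mul_one, ← Matrix.mul_assoc, ← Matrix.mul_assoc,
      mul_nonsing_inv S hSu, Matrix.one_mul]
  rw [h1, det_mul, det_one_add_mul_comm, ← Matrix.mul_assoc]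

/-- Push-through of a Loewner bound: `Xᴴ X ≤ l • S` (with `S` positive definite, `l > 0`)
implies `X S⁻¹ Xᴴ ≤ l • 1`. Proof via the two Schur-complement criteria for the block matrix
`[[l • S, Xᴴ], [X, 1]]`. [folklore] -/
theorem pushThrough_posSemidef {m : Type*} [Fintype m] [DecidableEq m]
    {S : Matrix n n ℝ} (hS : S.PosDef) (X : Matrix m n ℝ) {l : ℝ} (hl : 0 < l)
    (hle : (l • S - Xᴴ * X).PosSemidef) :
    (l • (1 : Matrix m m ℝ) - X * S⁻¹ * Xᴴ).PosSemidef := by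
  have hlS : (l • S).PosDef := hS.smul hl
  letI : Invertible (l • S) := hlS.isUnit.invertible
  have hSu : IsUnit S.det := (isUnit_iff_isUnit_det S).mp hS.isUnit
  letI : Invertible (1 : Matrix m m ℝ) := invertibleOne
  -- block matrix PSD, by the ₂₂ criterion (D = 1)
  have hblock : (fromBlocks (l • S) Xᴴ Xᴴᴴ (1 : Matrix m m ℝ)).PosSemidef := by
    rw [PosDef.fromBlocks₂₂ (l • S) Xᴴ PosDef.one]
    simpa using hle
  -- read it with the ₁₁ criterion (A = l • S)
  rw [PosDef.fromBlocks₁₁ Xᴴ (1 : Matrix m m ℝ) hlS] at hblock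
  have hinv : (l • S)⁻¹ = l⁻¹ • S⁻¹ := by
    letI : Invertible l := invertibleOfNonzero hl.ne'
    rw [Matrix.inv_smul (A := S) l hSu, invOf_eq_inv]
  rw [conjTranspose_conjTranspose, hinv] at hblock
  have h2 := hblock.smul hl.le
  have h3 : l • ((1 : Matrix m m ℝ) - X * (l⁻¹ • S⁻¹) * Xᴴ) = l • 1 - X * S⁻¹ * Xᴴ := by
    rw [smul_sub, Matrix.mul_smul, Matrix.smul_mul, smul_smul, mul_inv_cancel₀ hl.ne', one_smul]
  rwa [h3] at h2

/-- **Fischer side.** `det S ≤ det (S + W)` for `S` positive definite, `W` positive semidefinite. [folklore] -/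
theorem det_le_det_add {S W : Matrix n n ℝ} (hS : S.PosDef) (hW : W.PosSemidef) :
    S.det ≤ (S + W).det := by
  obtain ⟨X, hX, hXX⟩ := exists_symm_mul_self_of_posSemidef hW
  have hXh : Xᴴ = X := hX.1
  have hW' : W = Xᴴ * X := by rw [hXh, hXX]
  rw [hW', det_add_conjTranspose_mul_self hS X]
  have hN : (X * S⁻¹ * Xᴴ).PosSemidef := hS.inv.posSemidef.mul_mul_conjTranspose_same X
  have := one_le_det_one_add hN
  have hdet := hS.det_pos
  nlinarith

/-- **Collar side.** `det (S + W) ≤ (1 + l)^r · det S` for `S` positive definite, `W` positive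
semidefinite of rank `≤ r` with `W ≤ l • S` (`l ≥ 0`). [folklore] -/
theorem det_add_le_pow_mul_det {S W : Matrix n n ℝ} (hS : S.PosDef) (hW : W.PosSemidef)
    {l : ℝ} (hl : 0 ≤ l) (hle : (l • S - W).PosSemidef) {r : ℕ} (hr : W.rank ≤ r) :
    (S + W).det ≤ (1 + l) ^ r * S.det := by
  rcases hl.eq_or_lt with hl0 | hlpos
  · -- `l = 0`: then `W ≤ 0 ≤ W`, so `W = 0`.
    subst hl0
    rw [zero_smul, zero_sub] at hle
    have hW0 : W = 0 :=
      le_antisymm (by rw [Matrix.le_iff, zero_sub]; exact hle) hW.nonneg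
    subst hW0
    simp
  obtain ⟨X, hX, hXX⟩ := exists_symm_mul_self_of_posSemidef hW
  have hXh : Xᴴ = X := hX.1
  have hW' : W = Xᴴ * X := by rw [hXh, hXX]
  rw [hW', det_add_conjTranspose_mul_self hS X]
  have hN : (X * S⁻¹ * Xᴴ).PosSemidef := hS.inv.posSemidef.mul_mul_conjTranspose_same X
  have hrank : (X * S⁻¹ * Xᴴ).rank ≤ r := by
    calc (X * S⁻¹ * Xᴴ).rank ≤ (X * S⁻¹).rank := rank_mul_le_left _ _
      _ ≤ X.rank := rank_mul_le_left _ _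
      _ = (Xᴴ * X).rank := (rank_conjTranspose_mul_self X).symm
      _ = W.rank := by rw [hW']
      _ ≤ r := hr
  have hpush := pushThrough_posSemidef hS X hlpos (by rwa [← hW'])
  have h1 := det_one_add_le_pow_of_rank_le hN hl hpush hrank
  have hdet := hS.det_pos
  nlinarith

end General

/-! ## §3 Block form: Schur complement, Fischer and collar bounds -/

section Block

variable {m k : Type*} [Fintype m] [Fintype k] [DecidableEq m] [DecidableEq k]

/-- A matrix dominating `c • 1` with `c > 0` is positive definite. [folklore] -/
theorem posDef_of_sub_smul_one {S : Matrix m m ℝ} {c : ℝ} (hc : 0 < c)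
    (h : (S - c • (1 : Matrix m m ℝ)).PosSemidef) : S.PosDef := by
  classical
  have hSh : S.IsHermitian := by
    have h1 : S = (S - c • 1) + c • (1 : Matrix m m ℝ) := by rw [sub_add_cancel]
    rw [h1]
    refine h.1.add ?_
    change (c • (1 : Matrix m m ℝ))ᴴ = c • 1
    rw [conjTranspose_smul, conjTranspose_one, star_trivial]
  refine PosDef.of_dotProduct_mulVec_pos hSh fun x hx => ?_
  have hq := h.dotProduct_mulVec_nonneg x
  rw [sub_mulVec, dotProduct_sub, Matrix.smul_mulVec, one_mulVec, dotProduct_smul] at hq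
  have hxx : 0 < star x ⬝ᵥ x := dotProduct_star_self_pos_iff.mpr hx
  have : 0 < c • (star x ⬝ᵥ x) := by rw [smul_eq_mul]; positivity
  linarith

/-- **Uniform positivity passes to the Schur complement.** If the symmetric block matrix
`M = [[A, B], [Bᴴ, D]]` satisfies `M ≥ c • 1` (`D` positive definite), then its Schur complement
`A - B D⁻¹ Bᴴ ≥ c • 1` (complete the square with `y = -(D⁻¹ Bᴴ) x`). [folklore] -/
theorem schur_sub_smul_one_posSemidef (A : Matrix m m ℝ) (B : Matrix m k ℝ) {D : Matrix k k ℝ}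
    (hD : D.PosDef) {c : ℝ} (hc : 0 ≤ c)
    (hM : (fromBlocks A B Bᴴ D - c • (1 : Matrix (m ⊕ k) (m ⊕ k) ℝ)).PosSemidef) :
    (A - B * D⁻¹ * Bᴴ - c • (1 : Matrix m m ℝ)).PosSemidef := by
  letI : Invertible D := hD.isUnit.invertible
  have hMh : (fromBlocks A B Bᴴ D).IsHermitian := by
    have h1 : fromBlocks A B Bᴴ D = (fromBlocks A B Bᴴ D - c • 1) + c • 1 := by
      rw [sub_add_cancel]
    rw [h1]
    refine hM.1.add ?_
    change (c • (1 : Matrix (m ⊕ k) (m ⊕ k) ℝ))ᴴ = c • 1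
    rw [conjTranspose_smul, conjTranspose_one, star_trivial]
  have hAh : A.IsHermitian := (isHermitian_fromBlocks_iff.mp hMh).1
  have hSh : (A - B * D⁻¹ * Bᴴ).IsHermitian :=
    hAh.sub (isHermitian_mul_mul_conjTranspose B hD.1.inv)
  have hSch : (A - B * D⁻¹ * Bᴴ - c • (1 : Matrix m m ℝ)).IsHermitian := by
    refine hSh.sub ?_
    change (c • (1 : Matrix m m ℝ))ᴴ = c • 1
    rw [conjTranspose_smul, conjTranspose_one, star_trivial]
  refine PosSemidef.of_dotProduct_mulVec_nonneg hSch fun x => ?_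
  -- complete the square
  set y : k → ℝ := -((D⁻¹ * Bᴴ) *ᵥ x) with hy
  have hq := hM.dotProduct_mulVec_nonneg (x ⊕ᵥ y)
  rw [sub_mulVec, dotProduct_sub, Matrix.smul_mulVec, one_mulVec, dotProduct_smul,
    dotProduct_mulVec, schur_complement_eq₂₂ A B x y hD.1] at hq
  have hzero : (D⁻¹ * Bᴴ) *ᵥ x + y = 0 := by rw [hy, add_neg_cancel]
  rw [hzero, star_zero, zero_vecMul, zero_dotProduct, zero_add, ← dotProduct_mulVec] at hq
  -- `star (x ⊕ᵥ y) ⬝ᵥ (x ⊕ᵥ y) ≥ star x ⬝ᵥ x`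
  have hsum : star (x ⊕ᵥ y) ⬝ᵥ (x ⊕ᵥ y) = star x ⬝ᵥ x + star y ⬝ᵥ y := by
    simp [dotProduct, Fintype.sum_sum_type]
  have hyy : 0 ≤ star y ⬝ᵥ y := dotProduct_star_self_nonneg y
  rw [sub_mulVec, dotProduct_sub, Matrix.smul_mulVec, one_mulVec, dotProduct_smul]
  rw [hsum, smul_add] at hq
  have : 0 ≤ c • (star y ⬝ᵥ y) := by rw [smul_eq_mul]; exact mul_nonneg hc hyy
  linarith

/-- **Fischer's inequality** (block form): `det M ≤ det A · det D` for the positive definite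
symmetric block matrix `M = [[A, B], [Bᴴ, D]]`. [folklore] -/
theorem det_fromBlocks_le (A : Matrix m m ℝ) (B : Matrix m k ℝ) {D : Matrix k k ℝ}
    (hD : D.PosDef) {c : ℝ} (hc : 0 < c)
    (hM : (fromBlocks A B Bᴴ D - c • (1 : Matrix (m ⊕ k) (m ⊕ k) ℝ)).PosSemidef) :
    (fromBlocks A B Bᴴ D).det ≤ A.det * D.det := by
  letI : Invertible D := hD.isUnit.invertible
  have hS : (A - B * D⁻¹ * Bᴴ).PosDef :=
    posDef_of_sub_smul_one hc (schur_sub_smul_one_posSemidef A B hD hc.le hM)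
  have hW : (B * D⁻¹ * Bᴴ).PosSemidef := hD.inv.posSemidef.mul_mul_conjTranspose_same B
  have hdet : (fromBlocks A B Bᴴ D).det = D.det * (A - B * D⁻¹ * Bᴴ).det := by
    rw [det_fromBlocks₂₂, invOf_eq_nonsing_inv]
  have h1 := det_le_det_add hS hW
  rw [sub_add_cancel] at h1
  rw [hdet, mul_comm]
  exact mul_le_mul_of_nonneg_right h1 hD.det_pos.le

/-- **Collar inequality** (block form): if moreover `A ≤ a • 1` and `rank B ≤ r`, then
`det A · det D ≤ (1 + a / c)^r · det M`. Together with Fischer's inequality: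
`1 ≤ det A · det D / det M ≤ (1 + a/c)^r`, a bound depending on the coupling block `B` only
through its rank (`≤` the number of coupled boundary sites). [folklore] -/
theorem det_mul_det_le_pow_mul_det_fromBlocks (A : Matrix m m ℝ) (B : Matrix m k ℝ)
    {D : Matrix k k ℝ} (hD : D.PosDef) {c a : ℝ} (hc : 0 < c) (ha : 0 ≤ a)
    (hM : (fromBlocks A B Bᴴ D - c • (1 : Matrix (m ⊕ k) (m ⊕ k) ℝ)).PosSemidef)
    (hA : (a • (1 : Matrix m m ℝ) - A).PosSemidef) {r : ℕ} (hr : B.rank ≤ r) :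
    A.det * D.det ≤ (1 + a / c) ^ r * (fromBlocks A B Bᴴ D).det := by
  letI : Invertible D := hD.isUnit.invertible
  have hSc := schur_sub_smul_one_posSemidef A B hD hc.le hM
  have hS : (A - B * D⁻¹ * Bᴴ).PosDef := posDef_of_sub_smul_one hc hSc
  have hW : (B * D⁻¹ * Bᴴ).PosSemidef := hD.inv.posSemidef.mul_mul_conjTranspose_same B
  have hdet : (fromBlocks A B Bᴴ D).det = D.det * (A - B * D⁻¹ * Bᴴ).det := by
    rw [det_fromBlocks₂₂, invOf_eq_nonsing_inv]
  have hrank : (B * D⁻¹ * Bᴴ).rank ≤ r :=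
    ((rank_mul_le_left _ _).trans (rank_mul_le_left _ _)).trans hr
  -- Loewner bound `W ≤ (a/c) • S`:  (a/c) • S - W = (a/c) • (S - c • 1) + (a • 1 - A) + S
  have hle : ((a / c) • (A - B * D⁻¹ * Bᴴ) - B * D⁻¹ * Bᴴ).PosSemidef := by
    have hdecomp : (a / c) • (A - B * D⁻¹ * Bᴴ) - B * D⁻¹ * Bᴴ =
        (a / c) • (A - B * D⁻¹ * Bᴴ - c • (1 : Matrix m m ℝ)) + (a • 1 - A)
          + (A - B * D⁻¹ * Bᴴ) := by
      set l := a / c with hl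
      have hac : a = l * c := by rw [hl, div_mul_cancel₀ a hc.ne']
      rw [hac]
      ext i j
      simp only [Matrix.sub_apply, Matrix.add_apply, Matrix.smul_apply, smul_eq_mul]
      ring
    rw [hdecomp]
    exact ((hSc.smul (div_nonneg ha hc.le)).add hA).add hS.posSemidef
  have h1 := det_add_le_pow_mul_det hS hW (div_nonneg ha hc.le) hle hrank
  rw [sub_add_cancel] at h1
  rw [hdet]
  calc A.det * D.det ≤ ((1 + a / c) ^ r * (A - B * D⁻¹ * Bᴴ).det) * D.det :=
        mul_le_mul_of_nonneg_right h1 hD.det_pos.le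
    _ = (1 + a / c) ^ r * (D.det * (A - B * D⁻¹ * Bᴴ).det) := by ring

/-- The **collar ratio** `det A · det D / det M` lies in `[1, (1 + a/c)^r]`. [folklore] -/
theorem collarRatio_bounds (A : Matrix m m ℝ) (B : Matrix m k ℝ)
    {D : Matrix k k ℝ} (hD : D.PosDef) {c a : ℝ} (hc : 0 < c) (ha : 0 ≤ a)
    (hM : (fromBlocks A B Bᴴ D - c • (1 : Matrix (m ⊕ k) (m ⊕ k) ℝ)).PosSemidef)
    (hA : (a • (1 : Matrix m m ℝ) - A).PosSemidef) {r : ℕ} (hr : B.rank ≤ r) :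
    1 ≤ A.det * D.det / (fromBlocks A B Bᴴ D).det ∧
      A.det * D.det / (fromBlocks A B Bᴴ D).det ≤ (1 + a / c) ^ r := by
  have hMpos : 0 < (fromBlocks A B Bᴴ D).det := (posDef_of_sub_smul_one hc hM).det_pos
  constructor
  · rw [le_div_iff₀ hMpos, one_mul]
    exact det_fromBlocks_le A B hD hc hM
  · rw [div_le_iff₀ hMpos]
    exact det_mul_det_le_pow_mul_det_fromBlocks A B hD hc ha hM hA hr

end Block

/-! ## §4 Packaging for the territory comparison: the (a)-half of `NormLocality` in the Gaussian model -/

section Packaging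

open MeasureTheory T4HistoryPeeling T4InsertionProfile T4TerritoryComparison T4TerritoryReflection

/-- Real packaging: `√q ≤ exp ((log (1 + t) / 2) · s)` whenever `q ≤ (1 + t)^r`, `r ≤ s`, `t ≥ 0`. [folklore] -/
theorem sqrt_le_exp_of_le_pow {q t s : ℝ} {r : ℕ} (ht : 0 ≤ t) (hq : q ≤ (1 + t) ^ r)
    (hrs : (r : ℝ) ≤ s) : Real.sqrt q ≤ Real.exp (Real.log (1 + t) / 2 * s) := by
  have h1t : 0 < 1 + t := by linarith
  have hlog : 0 ≤ Real.log (1 + t) := Real.log_nonneg (by linarith)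
  calc Real.sqrt q ≤ Real.sqrt ((1 + t) ^ r) := Real.sqrt_le_sqrt hq
    _ = Real.exp (Real.log (1 + t) * ((r : ℝ) / 2)) := by
        rw [Real.sqrt_eq_rpow, ← Real.rpow_natCast, ← Real.rpow_mul h1t.le,
          Real.rpow_def_of_pos h1t]
        ring_nf
    _ ≤ Real.exp (Real.log (1 + t) / 2 * s) := by
        apply Real.exp_le_exp.mpr
        nlinarith

variable {ι : Type*} {T : Finset ι} {n : ℕ} {σ : Type*} {Ω : Type*} [MeasurableSpace Ω]

variable {Φ : SwitchOff T n} {Aω : ι → ℝ} {μ : Measure Ω} {F : FibreModel T Aω μ}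
  {X : TerritoryFactorisation Φ F} {shape : Fin n → ι → σ} {cost : Fin n → σ → ℝ}

/-- **The (a)-half of O2′ in the Gaussian model.** If, at every pending position and every exterior
datum, the re-inserted reference normalisation `norm` is at most the territory block normalisation `nT`
times the square root of a collar ratio `q ≤ (1 + t)^rk` (as delivered by `collarRatio_bounds` for the
step's block precision form, `t = a/c`, `rk =` rank of the territory × exterior coupling block), and the
collar rank is dominated by the territory cost, then `NormLocality` holds with constant `log (1 + t) / 2`
and zero slack. The (b)-half of O2′ (background oscillation) is exactly the hypothesis `hnorm`. [folklore] -/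
theorem normLocality_of_collar {nT q : Fin n → ι → Ω → ℝ} {rk : Fin n → ι → ℕ} {t : ℝ}
    (ht : 0 ≤ t) (hnT : ∀ i τ ω, 0 ≤ nT i τ ω)
    (hnorm : ∀ i, ∀ τ ∈ T, Φ.pend i τ = true → ∀ ω,
      X.norm i τ ω ≤ nT i τ ω * Real.sqrt (q i τ ω))
    (hq : ∀ i, ∀ τ ∈ T, Φ.pend i τ = true → ∀ ω, q i τ ω ≤ (1 + t) ^ rk i τ)
    (hrk : ∀ i, ∀ τ ∈ T, (rk i τ : ℝ) ≤ cost i (shape i τ)) :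
    NormLocality Φ X shape cost nT (Real.log (1 + t) / 2) (fun _ _ => 0) := by
  intro i τ hτ hp ω
  have hs := sqrt_le_exp_of_le_pow ht (hq i τ hτ hp ω) (hrk i τ hτ)
  have hn := hnorm i τ hτ hp ω
  have h0 := hnT i τ ω
  rw [add_zero]
  calc Real.exp (-(Real.log (1 + t) / 2 * cost i (shape i τ))) * X.norm i τ ω
      ≤ Real.exp (-(Real.log (1 + t) / 2 * cost i (shape i τ))) *
          (nT i τ ω * Real.exp (Real.log (1 + t) / 2 * cost i (shape i τ))) := by
        apply mul_le_mul_of_nonneg_left (hn.trans ?_) (Real.exp_nonneg _)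
        exact mul_le_mul_of_nonneg_left hs h0
    _ = nT i τ ω := by
        rw [Real.exp_neg]
        field_simp

/-- Sanity (non-vacuity, rank zero): with no coupling the bound is `det (1 + 0) ≤ (1 + l)^0 = 1`. -/
example (l : ℝ) (hl : 0 ≤ l) : ((1 : Matrix (Fin 3) (Fin 3) ℝ) + 0).det ≤ (1 + l) ^ 0 :=
  det_one_add_le_pow_of_rank_le PosSemidef.zero hl
    (by rw [sub_zero]; exact PosSemidef.one.smul hl) (by simp)

/-- Sanity (the packaging at zero cost and unit ratio): `exp 0 · norm ≤ nT` when `norm ≤ nT · √1`. -/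
example (x y : ℝ) (h : x ≤ y * Real.sqrt 1) :
    Real.exp (-(Real.log (1 + 0) / 2 * 0 + 0)) * x ≤ y := by
  simp only [Real.sqrt_one, mul_one] at h
  simpa using h

/-- Non-vacuity of `collarRatio_bounds` on a NON-degenerate instance (the cross-reader's item (2); added
in v1.1): one territory site coupled to one exterior site, `A = D = 2`, `B = 1`, i.e. `M = [[2, 1], [1, 2]]`,
with `c = 1`, `a = 2`, `r = 1` — all hypotheses hold simultaneously (`M − 1 = [[1, 1], [1, 1]] ≥ 0`) and
the conclusion reads `1 ≤ q ≤ 3` for `q = det A · det D / det M = 4/3`. -/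
example :
    1 ≤ ((2 : ℝ) • (1 : Matrix (Fin 1) (Fin 1) ℝ)).det * ((2 : ℝ) • (1 : Matrix (Fin 1) (Fin 1) ℝ)).det /
        (fromBlocks ((2 : ℝ) • (1 : Matrix (Fin 1) (Fin 1) ℝ)) 1 (1 : Matrix (Fin 1) (Fin 1) ℝ)ᴴ
          ((2 : ℝ) • 1)).det ∧
      ((2 : ℝ) • (1 : Matrix (Fin 1) (Fin 1) ℝ)).det * ((2 : ℝ) • (1 : Matrix (Fin 1) (Fin 1) ℝ)).det /
        (fromBlocks ((2 : ℝ) • (1 : Matrix (Fin 1) (Fin 1) ℝ)) 1 (1 : Matrix (Fin 1) (Fin 1) ℝ)ᴴ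
          ((2 : ℝ) • 1)).det ≤ (1 + 2 / 1) ^ 1 := by
  have h2 : ((2 : ℝ) • (1 : Matrix (Fin 1) (Fin 1) ℝ)).PosDef := PosDef.one.smul (by norm_num)
  refine collarRatio_bounds _ _ h2 one_pos (by norm_num) ?_ ?_ ?_
  · refine PosSemidef.of_dotProduct_mulVec_nonneg ?_ fun x => ?_
    · exact (IsHermitian.fromBlocks h2.1 rfl h2.1).sub (PosSemidef.one.smul zero_le_one).1
    · simp [Matrix.mulVec, dotProduct, fromBlocks, Fintype.sum_sum_type, Matrix.sub_apply,
        Matrix.smul_apply, Matrix.one_apply]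
      nlinarith [sq_nonneg (x (Sum.inl 0) + x (Sum.inr 0))]
  · simpa using (PosSemidef.zero : (0 : Matrix (Fin 1) (Fin 1) ℝ).PosSemidef)
  · exact (Matrix.rank_le_card_width _).trans (by simp)

end Packaging

end Literature.MathematicalPhysics.QuantumFieldTheory.Balaban1983to89.T4CollarDeterminant
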